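import Summits.QuantumFields.BalabanUV.T4Continuum.Support.ShellMeasureLandauExponent
import Summits.QuantumFields.BalabanUV.T4Continuum.Support.ShellMeasureLandauFixedPoint

/-!
# `T4Continuum.ShellMeasureLandauPrinted` — SM-L1 along the contraction ray, PRINTED-CONDITIONS EDITION: the numbers
# (118)/(121) and the (54)-smallness from Prop. 6's / Prop. 3's printed smallness, the ray through `H₁` from a
# (75)-bounded coarse field, the current `J ≡ 0`
# (cell `pub-balaban`, sub-cell `t4`, spine estimate NE7c (node U5b); NE7c formalisation swarm, crew seat
# `b2b-balaban-t4-ne7c-formalise-leaf-02` gen 2, OFFERED row S22 file 3; imports this row's files 1–2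
# `ShellMeasureLandauExponent` (p210095), `ShellMeasureLandauFixedPoint` (p210318) ONLY; 0 `def`, 0 sorry)

HONEST FRAMING.  Finite four-torus programme, rung (B)+1 only — NOT infinite volume, NOT a mass gap, NOT the Clay
problem, NOT summit progress; (B), `BetaPertHyp`, (B^μ) not consumed.  NE7c (`T4IndicatorShell.ShellWeightBound`) is
NOT PRINTED and NOT PROVED; «NE7c ⇐ the named binders».  File 2 of this row (`classifierWitness_of_prop6Scheme_sectC`)
produced END-II's SM-L1 = (AN-bound)_j witness from DISPLAYED-TYPE binders with the Landau correction `D` KERNEL along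
the ray; among its binders were the ABSTRACT numeric conditions of the two contraction schemes — `hdom`/`hself`/`hcontr`
((118)/(121) with free `j`, `a`, `θ`) and `hq`/`hRC` ((54) at `ε₄ + a`).  THIS FILE derives them from the PRINTED
smallness, by the tree's real arithmetic `B11.ineq118_121` ([Balaban1985Variational] p. 295: «These conditions are
satisfied if e.g. 2B₀C₁B₃ε₁ ≤ ε₄ and ε₄ ≤ a₄», a₄ unfolded as `4ε₄ ≤ a₃ ∧ 16B₀C₄ε₄ ≤ 1` exactly as in
`B11Prop6Scheme.prop6_solution`, with `dL ≤ B₃`) and by one line for Sect. C (p. 286: «for example we take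
9C₂B₀ε₃ ≦ 1/2, i.e. ε₃ ≦ (18C₂B₀)⁻¹»), at the printed sizes: current `J ≡ 0` ((171)/(175): no `𝔊J` at a minimiser
background — file 1 `currentData_zero`), background `𝔄_σ = H₁(B_σ)` with `‖B_σ‖ < 2dLC₁ε₁` ((75) «|B| < 2dLC₁ε₁»)
and `‖H₁ B‖ ≤ B₀‖B‖` ((103)) — file 1 `rayData_of_coarseField`, so `a = 2dLB₀C₁ε₁` LITERALLY the printed
«ε₄ + 2dLB₀C₁ε₁» of (118).  The ONE located coupling that is NOT a printed display: the ray's configurations (size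
`< ε₄ + 2dLB₀C₁ε₁ ≤ 2ε₄`) lie in Prop. 3's ε₃-domain — `hcoup : ε₄ + 2dLB₀C₁ε₁ ≤ ε₃` — together with B13's located
domain condition `3ε₃ ≤ R` (GAPS G-B13-02a).  Renders pp. 285–286 / 295 read as images by this seat / the b11
lineage (see files 1–2 and `B11Prop6Scheme`).  AFTER THIS FILE the census of SM-L1 on the file-2 road reads:
(AN-bound)_j ⇐ (P2) ∧ (P4) ∧ Prop. 6's printed smallness (`2B₀C₁B₃ε₁ ≤ ε₄ ≤ a₄`, `dL ≤ B₃`) ∧ (44)+[4] Prop. 7 ∧ (46)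
∧ Prop. 3's printed smallness `18C₂B₀ε₃ ≤ 1` ∧ the coupling `ε₄ + 2dLB₀C₁ε₁ ≤ ε₃`, `3ε₃ ≤ R` ∧ the coarse-field
family ((75), [6] (1.31) by reference) ∧ (103) ∧ read-out + holonomy dictionaries — DISPLAYED-TYPE / by-reference
binders; (118)/(121)/(54)-at-the-ray, `D`, (55) are kernel.  Nothing of the audited series is discharged.  0 sorry,
0 `def`.  HONEST DEPENDENCY (cell): continuum YM on T⁴ ⇐ BetaPertH ∧ nine spine estimates (0/9 proved); BetaPertH ⇐
(D1) ∧ (D4) ∧ CAP+tail; G-an2-4 gates asym, D1 and NE2/3/4.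
-/

noncomputable section

open Set Metric NormedSpace

namespace Summit.QuantumFields.BalabanUV.T4Continuum.ShellMeasureLandauPrinted

open Literature.MathematicalPhysics.QuantumFieldTheory.Balaban1983to89
open B11Prop6Scheme (mapT Prop4Hyp)
open ShellMeasureWilsonWords (wordExp)
open ShellMeasureLandauExponent (rayData_of_coarseField currentData_zero)
open ShellMeasureLandauFixedPoint (classifierWitness_of_prop6Scheme_sectC)

/-! ## §1 The numeric conditions from the printed smallness -/

/-- **(118)/(121) at the printed sizes with the current ABSENT** (`j = 0`, `θ = 0`, `a = 2dLB₀C₁ε₁`): from Prop. 6's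
printed smallness via `B11.ineq118_121` — the three numeric binders `hdom`/`hself`/`hcontr` of
`ShellMeasureMinimiserBonds.solutionFamily_of_prop6Scheme` / file 2's composite. [folklore] -/
theorem scheme_numbers_of_printed {dL B₀ C₁ C₄ B₃ a₃ ε₁ ε₄ : ℝ} (hdL : 0 ≤ dL) (hB₀ : 0 ≤ B₀) (hC₁ : 0 ≤ C₁)
    (hC₄ : 0 ≤ C₄) (hε₁ : 0 ≤ ε₁) (hε₄ : 0 ≤ ε₄) (hB₃ : dL ≤ B₃) (h1 : 2 * B₀ * C₁ * B₃ * ε₁ ≤ ε₄)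
    (h2 : 4 * ε₄ ≤ a₃) (h3 : 16 * B₀ * C₄ * ε₄ ≤ 1) :
    2 * (ε₄ + B₀ * (2 * dL * C₁ * ε₁)) ≤ a₃ ∧
      B₀ * 0 + 0 * (ε₄ + B₀ * (2 * dL * C₁ * ε₁)) + B₀ * C₄ * (ε₄ + B₀ * (2 * dL * C₁ * ε₁)) ^ 2 ≤ ε₄ ∧
      0 + 4 * B₀ * C₄ * (ε₄ + B₀ * (2 * dL * C₁ * ε₁)) < 1 ∧
      ε₄ + B₀ * (2 * dL * C₁ * ε₁) ≤ 2 * ε₄ := by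
  obtain ⟨⟨-, h118⟩, ⟨h121a, h121b⟩⟩ :=
    B11.ineq118_121 dL B₀ C₁ C₄ B₃ a₃ ε₁ ε₄ hdL hB₀ hC₁ hC₄ hε₁ hε₄ hB₃ h1 h2 h3
  have ha : B₀ * (2 * dL * C₁ * ε₁) = 2 * dL * B₀ * C₁ * ε₁ := by ring
  have hj : 0 ≤ B₀ * C₁ * B₃ * ε₁ := by
    have hB₃0 : 0 ≤ B₃ := hdL.trans hB₃
    positivity
  have hd : dL * (B₀ * C₁ * ε₁) ≤ B₃ * (B₀ * C₁ * ε₁) := mul_le_mul_of_nonneg_right hB₃ (by positivity)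
  rw [ha]
  refine ⟨by linarith, ?_, by linarith, by nlinarith⟩
  have : B₀ * 0 + 0 * (ε₄ + 2 * dL * B₀ * C₁ * ε₁) + B₀ * C₄ * (ε₄ + 2 * dL * B₀ * C₁ * ε₁) ^ 2 =
      B₀ * C₄ * (ε₄ + 2 * dL * B₀ * C₁ * ε₁) ^ 2 := by ring
  rw [this]
  linarith

/-- **the (54)-smallness at the ray from Prop. 3's printed example** «9C₂B₀ε₃ ≦ 1/2, i.e. ε₃ ≦ (18C₂B₀)⁻¹» and the
located coupling `ε ≤ ε₃` (the ray's configurations lie in Prop. 3's domain): `9C₂B₀ε < 1`; and the domain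
condition `3ε ≤ R` from `3ε₃ ≤ R`. [folklore] -/
theorem sectC_numbers_of_printed {C₂ B₀ ε ε₃ R : ℝ} (hC₂ : 0 ≤ C₂) (hB₀ : 0 ≤ B₀) (h18 : 18 * C₂ * B₀ * ε₃ ≤ 1)
    (hcoup : ε ≤ ε₃) (h3R : 3 * ε₃ ≤ R) : 9 * C₂ * B₀ * ε < 1 ∧ 3 * ε ≤ R := by
  have hmono : 9 * C₂ * B₀ * ε ≤ 9 * C₂ * B₀ * ε₃ := mul_le_mul_of_nonneg_left hcoup (by positivity)
  exact ⟨by linarith, by linarith⟩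

/-! ## §2 SM-L1 along the ray from the printed conditions, one call -/

section Composite

variable {𝒴 𝒴' 𝒳 𝒵 ℬ A : Type*} [NormedAddCommGroup 𝒴] [NormedSpace ℂ 𝒴] [CompleteSpace 𝒴]
  [NormedAddCommGroup 𝒴'] [NormedSpace ℂ 𝒴'] [NormedAddCommGroup 𝒳] [NormedSpace ℂ 𝒳] [CompleteSpace 𝒳]
  [NormedAddCommGroup 𝒵] [NormedSpace ℂ 𝒵] [NormedAddCommGroup ℬ] [NormedSpace ℂ ℬ]
  [NormedRing A] [NormedAlgebra ℂ A] [CompleteSpace A]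
  {𝒢 : 𝒵 →L[ℂ] 𝒴} {W : 𝒴 → 𝒵} {B₀ C₄ a₃ : ℝ}

/-- **SM-L1 = (AN-bound)_j ALONG THE CONTRACTION RAY FROM THE PRINTED CONDITIONS, ONE CALL.**  Binders: (P2) `h𝒢`
(𝔊, [5] Thm 3.13 by reference); (P4) `hW` (Prop. 4 (97)–(98), Fréchet form); Prop. 6's printed smallness `h1`/`h2`/
`h3` with `dL ≤ B₃`; the coarse-field family `B_σ` — holomorphic on the disc `‖σ‖ < Rad`, `B_0 = 0`, (75)
`‖B_σ‖ < 2dLC₁ε₁` — and (103) `‖H₁ B‖ ≤ B₀‖B‖`; (44)+[4] Prop. 7 `hCq`/`hCd`; the scaling `hι`; (46) `hH`; Prop. 3's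
printed smallness `18C₂B₀ε₃ ≤ 1` with the located coupling `ε₄ + 2dLB₀C₁ε₁ ≤ ε₃` and `3ε₃ ≤ R`; the read-outs; the
HOLONOMY DICTIONARY for `Ψ(Y_σ) = Y_σ − H D_σ` quantified over THE solution family of (111) (`J = 0`, Λ = 0,
𝔄 = H₁B) and THE fixed-point family of (50).  CONCLUSION: END-II's `hAN` witness on `ball 0 Rad` with
`H_AN = e^{m·κ·((ε₄ + 2dLB₀C₁ε₁) + 4C₂B₀(ε₄ + 2dLB₀C₁ε₁)²)} − 1`. [folklore] -/
theorem classifierWitness_of_printed (h𝒢 : ∀ f, ‖𝒢 f‖ ≤ B₀ * ‖f‖) (hW : Prop4Hyp W C₄ a₃) (hB₀ : 0 < B₀)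
    (hC₄ : 0 ≤ C₄) {dL C₁ B₃ ε₁ ε₄ : ℝ} (hdL : 0 ≤ dL) (hC₁ : 0 ≤ C₁) (hε₁ : 0 ≤ ε₁) (hε₄ : 0 ≤ ε₄)
    (hB₃ : dL ≤ B₃) (h1 : 2 * B₀ * C₁ * B₃ * ε₁ ≤ ε₄) (h2 : 4 * ε₄ ≤ a₃) (h3 : 16 * B₀ * C₄ * ε₄ ≤ 1)
    (H₁ : ℬ →L[ℂ] 𝒴) (hH₁ : ∀ B, ‖H₁ B‖ ≤ B₀ * ‖B‖) {Rad : ℝ} (hRad : 0 < Rad) {Bf : ℂ → ℬ}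
    (hBd : DifferentiableOn ℂ Bf (ball 0 Rad)) (hB : ∀ σ ∈ ball (0 : ℂ) Rad, ‖Bf σ‖ < 2 * dL * C₁ * ε₁)
    (hB0 : Bf 0 = 0)
    {C : 𝒴' → 𝒳} {C₂ R ε₃ : ℝ} (hC₂ : 0 ≤ C₂) (hCq : ∀ Z : 𝒴', ‖Z‖ < R → ‖C Z‖ ≤ C₂ * ‖Z‖ ^ 2)
    (hCd : DifferentiableOn ℂ C (ball 0 R)) (ι : 𝒴 →L[ℂ] 𝒴') (hι : ∀ Y, ‖ι Y‖ ≤ ‖Y‖) (H : 𝒳 →L[ℂ] 𝒴)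
    (hH : ∀ X, ‖H X‖ ≤ B₀ * ‖X‖) (h18 : 18 * C₂ * B₀ * ε₃ ≤ 1)
    (hcoup : ε₄ + B₀ * (2 * dL * C₁ * ε₁) ≤ ε₃) (h3R : 3 * ε₃ ≤ R)
    (ℓs : List (𝒴 →L[ℂ] A)) {κ : ℝ} (hκ : 0 ≤ κ) (hℓ : ∀ ℓ ∈ ℓs, ∀ Y, ‖ℓ Y‖ ≤ κ * ‖Y‖) {hol : ℝ → A}
    (hhol : ∀ X : ℂ → 𝒴, (∀ σ ∈ ball (0 : ℂ) Rad, ‖X σ‖ ≤ ε₄ ∧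
        mapT 𝒢 0 W (0 : 𝒵) (H₁ (Bf σ)) (X σ) = X σ) →
      ∀ D : ℂ → 𝒳, (∀ σ ∈ ball (0 : ℂ) Rad,
        D σ ∈ closedBall (0 : 𝒳) (4 * C₂ * (ε₄ + B₀ * (2 * dL * C₁ * ε₁)) ^ 2) ∧
        C (ι (X σ + H₁ (Bf σ)) - ι (H (D σ))) = D σ) →
      ∀ c : ℝ, 0 ≤ c → c ≤ 1 →
        hol c = wordExp (ℓs.map fun ℓ => ℓ ((X (c : ℂ) + H₁ (Bf (c : ℂ))) - H (D (c : ℂ))))) :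
    ∃ f : ℂ → A, DifferentiableOn ℂ f (ball 0 Rad) ∧
      (∀ w ∈ ball (0 : ℂ) Rad, ‖f w‖ ≤
        Real.exp (ℓs.length * (κ * ((ε₄ + B₀ * (2 * dL * C₁ * ε₁)) +
          B₀ * (4 * C₂ * (ε₄ + B₀ * (2 * dL * C₁ * ε₁)) ^ 2)))) - 1) ∧
      f 0 = 0 ∧ ∀ c : ℝ, 0 ≤ c → c ≤ 1 → f (c : ℂ) = hol c - 1 := by
  obtain ⟨hdom, hself, hcontr, -⟩ := scheme_numbers_of_printed hdL hB₀.le hC₁ hC₄ hε₁ hε₄ hB₃ h1 h2 h3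
  obtain ⟨hq, hRC⟩ := sectC_numbers_of_printed hC₂ hB₀.le h18 hcoup h3R
  obtain ⟨h𝔄d, h𝔄0, h𝔄⟩ := rayData_of_coarseField H₁ hH₁ hB₀ hBd hB hB0
  obtain ⟨hJd, hJ, hJ0⟩ := currentData_zero (𝒵 := 𝒵) Rad
  have hΛ : ∀ Y : 𝒴, ‖(0 : 𝒴 →L[ℂ] 𝒴) Y‖ ≤ 0 * ‖Y‖ := fun Y => by simp
  exact classifierWitness_of_prop6Scheme_sectC h𝒢 hΛ hW hB₀.le hC₄ le_rfl hε₄ hdom hself hcontr hRad hJd h𝔄d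
    hJ h𝔄 hJ0 h𝔄0 hC₂ hCq hCd ι hι H hH hq hRC ℓs hκ hℓ hhol

end Composite

end Summit.QuantumFields.BalabanUV.T4Continuum.ShellMeasureLandauPrinted
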